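import Literature.Computability.MetaComplexity.BoundedArithModels
import Literature.Computability.MetaComplexity.BoundedArithRelabel
import Literature.Computability.MetaComplexity.BoundedArithSyntaxProofs
import HarnessLib

/-!
# `Σᵇᵢ / Πᵇᵢ`-definability with parameters in a structure for bounded arithmetic

Trunk: CplxMeta (G14), topic `Literature/Computability/MetaComplexity` (companion of
`BoundedArithModels.lean`).  This is the working interface for arguing inside an arbitrary
model `M` of Buss's theories (bootstrapping, Buss 1986, Ch. 2; Buss 1990, §3): instead of
manipulating formulas, one manipulates *predicates* `P : (Fin m → M) → Prop` and *functions*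
`F : (Fin m → M) → M` on the structure that are known to be definable, with parameters from `M`,
by a formula of a given class, and applies the induction schemes to them.

* `IsTermFn F` — `F` is given by a term with parameters; `IsQFDef P`, `IsSigmabDef i P`,
  `IsPibDef i P` — `P` is definable with parameters by an open / `Σᵇᵢ` / `Πᵇᵢ` formula
  (Buss 1986, §2.1–2.2: formulas "with parameters"; Krajíček 1995, §5.2).
* Closure properties mirroring the generating clauses of the classes (Buss 1986, §2.1):
  Boolean connectives, bounded quantifiers `∃ y ≤ t`, `∀ y ≤ t` and sharply bounded ones,
  renaming / identification / instantiation of arguments, substitution of term functions,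
  cumulativity.
* `IsSigmabDef.induction` (**`Σᵇᵢ-IND` in models of `T₂ⁱ`**) and `IsSigmabDef.pinduction`
  (**`Σᵇᵢ-PIND` in models of `S₂ⁱ`**) for definable unary predicates with parameters
  (Buss 1986, §2.4, Definitions of `T₂ⁱ`, `S₂ⁱ`).

## Design choices

* Parameters are represented by *naming every element of `M` by itself*: a defining formula has
  free variables `M ⊕ Fin m` (`Sum.inl a` is realized by `a`, `Sum.inr j` by the `j`-th
  argument), exactly as formulas with parameters are represented in
  `Literature/ModelTheory/UniversalTheories/HerbrandSaturation.lean`.  Two definable predicates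
  thus live in the same variable space and no merging of parameter tuples is ever needed.
* To apply an induction axiom (an axiom about a formula with variables `Fin (k + 1)`), the
  finitely many parameters occurring in the defining formula are enumerated
  (`exists_formula_fin_of_isSigmabDef`), using `realize_congr_freeVarFinset` (the truth value
  of a formula depends only on the variables occurring in it) and the stability of the classes
  under relabelling (`BoundedArithRelabel.lean`).
* Structures live in `Type`, as in `BoundedArithModels.lean` and Mathlib's `⊨ᵇ` for this
  language.

## References

* S. R. Buss, *Bounded Arithmetic*, Bibliopolis 1986, §§2.1–2.4.
* J. Krajíček, *Bounded Arithmetic, Propositional Logic and Complexity Theory*, CUP 1995, §5.2.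
-/

namespace Literature.Computability.MetaComplexity

open FirstOrder FirstOrder.Language FirstOrder.Language.BoundedFormula

/-! ## Realization depends only on the variables that occur -/

section Congr

variable {L : Language} {α : Type*} {M : Type*} [L.Structure M] [DecidableEq α]

/-- The value of a term depends only on the assignment of the (left) variables occurring in it.
[folklore] -/
theorem realize_term_congr_left {n : ℕ} (t : L.Term (α ⊕ Fin n)) {v w : α → M}
    (xs : Fin n → M) (h : ∀ a ∈ t.varFinsetLeft, v a = w a) :
    t.realize (Sum.elim v xs) = t.realize (Sum.elim w xs) := by
  induction t with
  | var x =>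
    rcases x with a | j
    · simpa [Term.varFinsetLeft] using h a (by simp [Term.varFinsetLeft])
    · rfl
  | func f ts ih =>
    simp only [Term.realize]
    congr 1
    funext j
    exact ih j fun a ha => h a (by
      simp only [Term.varFinsetLeft, Finset.mem_biUnion, Finset.mem_univ, true_and]
      exact ⟨j, ha⟩)

/-- The truth value of a bounded formula depends only on the assignment of the free variables
occurring in it. [folklore] -/
theorem realize_congr_freeVarFinset :
    ∀ {n : ℕ} (φ : L.BoundedFormula α n) {v w : α → M} (xs : Fin n → M),
      (∀ a ∈ φ.freeVarFinset, v a = w a) → (φ.Realize v xs ↔ φ.Realize w xs)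
  | _, falsum, _, _, _, _ => Iff.rfl
  | _, equal t₁ t₂, v, w, xs, h => by
    simp only [Realize]
    rw [realize_term_congr_left t₁ xs fun a ha => h a (by simp [freeVarFinset, ha]),
      realize_term_congr_left t₂ xs fun a ha => h a (by simp [freeVarFinset, ha])]
  | _, rel R ts, v, w, xs, h => by
    simp only [Realize]
    refine iff_of_eq (congrArg _ (funext fun i => ?_))
    exact realize_term_congr_left (ts i) xs fun a ha => h a (by
      simp only [freeVarFinset, Finset.mem_biUnion, Finset.mem_univ, true_and]
      exact ⟨i, ha⟩)
  | _, imp φ ψ, v, w, xs, h => by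
    simp only [Realize]
    rw [realize_congr_freeVarFinset φ xs fun a ha => h a (by simp [freeVarFinset, ha]),
      realize_congr_freeVarFinset ψ xs fun a ha => h a (by simp [freeVarFinset, ha])]
  | _, all φ, v, w, xs, h => by
    simp only [Realize]
    exact forall_congr' fun a => realize_congr_freeVarFinset φ (Fin.snoc xs a) h

end Congr

/-! ### Evaluation of `Fin.snoc` at numerals (small arities) -/

section SnocEval

variable {M : Type*}

/-- Evaluation of `Fin.snoc` on `Fin 1 → M`, first coordinate. [folklore] -/
@[simp] theorem snoc_fin_one_zero (v : Fin 1 → M) (y : M) : (Fin.snoc v y : Fin 2 → M) 0 = v 0 :=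
  rfl

/-- Evaluation of `Fin.snoc` on `Fin 1 → M`, last coordinate. [folklore] -/
@[simp] theorem snoc_fin_one_one (v : Fin 1 → M) (y : M) : (Fin.snoc v y : Fin 2 → M) 1 = y :=
  rfl

/-- Evaluation of `Fin.snoc` on `Fin 2 → M`, coordinate `0`. [folklore] -/
@[simp] theorem snoc_fin_two_zero (w : Fin 2 → M) (y : M) : (Fin.snoc w y : Fin 3 → M) 0 = w 0 :=
  rfl

/-- Evaluation of `Fin.snoc` on `Fin 2 → M`, coordinate `1`. [folklore] -/
@[simp] theorem snoc_fin_two_one (w : Fin 2 → M) (y : M) : (Fin.snoc w y : Fin 3 → M) 1 = w 1 :=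
  rfl

/-- Evaluation of `Fin.snoc` on `Fin 2 → M`, last coordinate. [folklore] -/
@[simp] theorem snoc_fin_two_two (w : Fin 2 → M) (y : M) : (Fin.snoc w y : Fin 3 → M) 2 = y :=
  rfl

/-- Evaluation of `Fin.snoc` on `Fin 3 → M`, coordinate `0`. [folklore] -/
@[simp] theorem snoc_fin_three_zero (w : Fin 3 → M) (y : M) :
    (Fin.snoc w y : Fin 4 → M) 0 = w 0 := rfl

/-- Evaluation of `Fin.snoc` on `Fin 3 → M`, coordinate `1`. [folklore] -/
@[simp] theorem snoc_fin_three_one (w : Fin 3 → M) (y : M) :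
    (Fin.snoc w y : Fin 4 → M) 1 = w 1 := rfl

/-- Evaluation of `Fin.snoc` on `Fin 3 → M`, coordinate `2`. [folklore] -/
@[simp] theorem snoc_fin_three_two (w : Fin 3 → M) (y : M) :
    (Fin.snoc w y : Fin 4 → M) 2 = w 2 := rfl

/-- Evaluation of `Fin.snoc` on `Fin 3 → M`, last coordinate. [folklore] -/
@[simp] theorem snoc_fin_three_three (w : Fin 3 → M) (y : M) :
    (Fin.snoc w y : Fin 4 → M) 3 = y := rfl

end SnocEval

/-! ## Definable predicates and functions -/

section Definability

variable {M : Type} [Language.boundedArith.Structure M] {m : ℕ}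

/-- The assignment naming every parameter `a ∈ M` by itself and the `j`-th argument variable by
`xs j`. [folklore] -/
abbrev argEnv (xs : Fin m → M) : M ⊕ Fin m → M := Sum.elim id xs

/-- `IsTermFn F`: the function `F : Mᵐ → M` is given by a term of the language of bounded
arithmetic with parameters from `M` (Buss 1986, §2.2: terms with parameters).
[cite: Buss1986, §2.2] -/
def IsTermFn (F : (Fin m → M) → M) : Prop :=
  ∃ t : Language.boundedArith.Term (M ⊕ Fin m), ∀ xs, F xs = t.realize (argEnv xs)

/-- `IsQFDef P`: the predicate `P ⊆ Mᵐ` is definable by an open (quantifier-free) formula with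
parameters from `M` (Buss 1986, §2.1). [cite: Buss1986, §2.1] -/
def IsQFDef (P : (Fin m → M) → Prop) : Prop :=
  ∃ φ : Language.boundedArith.Formula (M ⊕ Fin m), φ.IsQF ∧ ∀ xs, P xs ↔ φ.Realize (argEnv xs)

/-- `IsSigmabDef i P`: the predicate `P ⊆ Mᵐ` is definable by a `Σᵇᵢ` formula with parameters
from `M` (Buss 1986, §2.1; the `Σᵇᵢ`-formulas-with-parameters to which the induction schemes of
§2.4 apply). [cite: Buss1986, §2.1] -/
def IsSigmabDef (i : ℕ) (P : (Fin m → M) → Prop) : Prop :=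
  ∃ φ : Language.boundedArith.Formula (M ⊕ Fin m),
    IsSigmab i φ ∧ ∀ xs, P xs ↔ φ.Realize (argEnv xs)

/-- `IsPibDef i P`: the predicate `P ⊆ Mᵐ` is definable by a `Πᵇᵢ` formula with parameters
from `M` (Buss 1986, §2.1). [cite: Buss1986, §2.1] -/
def IsPibDef (i : ℕ) (P : (Fin m → M) → Prop) : Prop :=
  ∃ φ : Language.boundedArith.Formula (M ⊕ Fin m),
    IsPib i φ ∧ ∀ xs, P xs ↔ φ.Realize (argEnv xs)

/-- `IsDeltabDef i P`: `P` is both `Σᵇᵢ`- and `Πᵇᵢ`-definable with parameters in `M` (`Δᵇᵢ`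
with respect to the structure; Buss 1986, §2.2). [cite: Buss1986, §2.2] -/
def IsDeltabDef (i : ℕ) (P : (Fin m → M) → Prop) : Prop :=
  IsSigmabDef i P ∧ IsPibDef i P

/-! ### Variable maps -/

/-- Renaming of the argument variables along `g`, parameters fixed. [folklore] -/
def argMap {m' : ℕ} (g : Fin m' → Fin m) : M ⊕ Fin m' → M ⊕ Fin m := Sum.map id g

omit [Language.boundedArith.Structure M] in
/-- `argEnv xs ∘ argMap g = argEnv (xs ∘ g)`. [folklore] -/
@[simp] theorem argEnv_comp_argMap {m' : ℕ} (g : Fin m' → Fin m) (xs : Fin m → M) :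
    argEnv xs ∘ argMap g = argEnv (xs ∘ g) := by
  funext x; rcases x with a | j <;> rfl

/-- The substitution instantiating the last argument variable by the term `t` (in the other
arguments and parameters). [folklore] -/
def snocSubst (t : Language.boundedArith.Term (M ⊕ Fin m)) :
    M ⊕ Fin (m + 1) → Language.boundedArith.Term (M ⊕ Fin m) :=
  Sum.elim (fun a => var (Sum.inl a)) (Fin.lastCases t fun j => var (Sum.inr j))

/-- Semantics of `snocSubst`, pointwise. [folklore] -/
@[simp] theorem realize_snocSubst_apply (t : Language.boundedArith.Term (M ⊕ Fin m))
    (xs : Fin m → M) (x : M ⊕ Fin (m + 1)) :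
    (snocSubst t x).realize (argEnv xs) = argEnv (Fin.snoc xs (t.realize (argEnv xs))) x := by
  rcases x with a | j
  · rfl
  · cases j using Fin.lastCases with
    | last => simp [snocSubst]
    | cast j => simp [snocSubst]

/-- Semantics of `snocSubst`. [folklore] -/
theorem realize_snocSubst (t : Language.boundedArith.Term (M ⊕ Fin m)) (xs : Fin m → M) :
    (fun x => (snocSubst t x).realize (argEnv xs)) =
      argEnv (Fin.snoc xs (t.realize (argEnv xs))) :=
  funext (realize_snocSubst_apply t xs)

/-- The relabelling moving the last argument variable into the (single) context variable, used
to bind it by a bounded quantifier. [folklore] -/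
def bindLast : M ⊕ Fin (m + 1) → (M ⊕ Fin m) ⊕ Fin 1 :=
  Sum.elim (Sum.inl ∘ Sum.inl) (Fin.lastCases (Sum.inr 0) fun j => Sum.inl (Sum.inr j))

omit [Language.boundedArith.Structure M] in
/-- Semantics of `bindLast`: the assignment seen by a formula relabelled along `bindLast`.
[folklore] -/
theorem elim_comp_bindLast (xs : Fin m → M) (y : Fin (1 + 0) → M) :
    Sum.elim (argEnv xs) (y ∘ Fin.castAdd 0) ∘ bindLast = argEnv (Fin.snoc xs (y 0)) := by
  funext x
  rcases x with a | j
  · rfl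
  · cases j using Fin.lastCases with
    | last => simp [bindLast]
    | cast j => simp [bindLast]

/-- Semantics of relabelling along `bindLast`. [folklore] -/
theorem realize_relabel_bindLast (φ : Language.boundedArith.Formula (M ⊕ Fin (m + 1)))
    (xs : Fin m → M) (a : M) :
    (BoundedFormula.relabel (bindLast (M := M) (m := m)) φ).Realize (argEnv xs)
        (Fin.snoc (default : Fin 0 → M) a) ↔
      φ.Realize (argEnv (Fin.snoc xs a)) := by
  rw [realize_relabel, elim_comp_bindLast]
  have h0 : (Fin.snoc (default : Fin 0 → M) a : Fin 1 → M) 0 = a := Fin.snoc_last _ _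
  simp only [Formula.Realize, h0]
  exact Iff.of_eq (congrArg _ (Subsingleton.elim _ _))

/-! ### Term functions -/

namespace IsTermFn

/-- Projections are term functions. [folklore] -/
theorem proj (j : Fin m) : IsTermFn (fun xs : Fin m → M => xs j) :=
  ⟨var (Sum.inr j), fun _ => rfl⟩

/-- Constants (parameters) are term functions. [folklore] -/
theorem const (a : M) : IsTermFn (fun _ : Fin m → M => a) :=
  ⟨var (Sum.inl a), fun _ => rfl⟩

/-- `0` is a term function. [folklore] -/
theorem zero : IsTermFn (fun _ : Fin m → M => mZero M) :=
  ⟨0, fun xs => (realize_term_zero (argEnv xs)).symm⟩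

variable {F G : (Fin m → M) → M}

/-- Term functions are closed under `S`. [folklore] -/
theorem succ (hF : IsTermFn F) : IsTermFn fun xs => mSucc (F xs) := by
  obtain ⟨t, ht⟩ := hF
  exact ⟨Term.succ t, fun xs => by simp only [realize_term_succ, ht]⟩

/-- Term functions are closed under `⌊·/2⌋`. [folklore] -/
theorem half (hF : IsTermFn F) : IsTermFn fun xs => mHalf (F xs) := by
  obtain ⟨t, ht⟩ := hF
  exact ⟨Term.half t, fun xs => by simp only [realize_term_half, ht]⟩

/-- Term functions are closed under `|·|`. [folklore] -/
theorem len (hF : IsTermFn F) : IsTermFn fun xs => mLen (F xs) := by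
  obtain ⟨t, ht⟩ := hF
  exact ⟨Term.len t, fun xs => by simp only [realize_term_len, ht]⟩

/-- Term functions are closed under `+`. [folklore] -/
theorem add (hF : IsTermFn F) (hG : IsTermFn G) : IsTermFn fun xs => mAdd (F xs) (G xs) := by
  obtain ⟨t, ht⟩ := hF
  obtain ⟨s, hs⟩ := hG
  exact ⟨t + s, fun xs => by simp only [realize_term_add, ht, hs]⟩

/-- Term functions are closed under `·`. [folklore] -/
theorem mul (hF : IsTermFn F) (hG : IsTermFn G) : IsTermFn fun xs => mMul (F xs) (G xs) := by
  obtain ⟨t, ht⟩ := hF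
  obtain ⟨s, hs⟩ := hG
  exact ⟨t * s, fun xs => by simp only [realize_term_mul, ht, hs]⟩

/-- Term functions are closed under `#`. [folklore] -/
theorem smash (hF : IsTermFn F) (hG : IsTermFn G) :
    IsTermFn fun xs => mSmash (F xs) (G xs) := by
  obtain ⟨t, ht⟩ := hF
  obtain ⟨s, hs⟩ := hG
  exact ⟨Term.smash t s, fun xs => by simp only [realize_term_smash, ht, hs]⟩

/-- Term functions are closed under renaming of arguments. [folklore] -/
theorem comp {m' : ℕ} {F : (Fin m' → M) → M} (hF : IsTermFn F) (g : Fin m' → Fin m) :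
    IsTermFn fun xs : Fin m → M => F (xs ∘ g) := by
  obtain ⟨t, ht⟩ := hF
  refine ⟨t.relabel (argMap g), fun xs => ?_⟩
  dsimp only
  rw [Term.realize_relabel, argEnv_comp_argMap, ht]

/-- Term functions are closed under substitution of a term function for the last argument.
[folklore] -/
theorem snoc {F : (Fin (m + 1) → M) → M} (hF : IsTermFn F) (hG : IsTermFn G) :
    IsTermFn fun xs : Fin m → M => F (Fin.snoc xs (G xs)) := by
  obtain ⟨t, ht⟩ := hF
  obtain ⟨s, hs⟩ := hG
  refine ⟨t.subst (snocSubst s), fun xs => ?_⟩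
  dsimp only
  rw [Term.realize_subst, realize_snocSubst, ← hs, ht]

end IsTermFn

/-! ### Open (quantifier-free) definability -/

namespace IsQFDef

variable {P Q : (Fin m → M) → Prop} {F G : (Fin m → M) → M}

/-- `F x̄ ≤ G x̄` is open-definable for term functions `F`, `G`. [folklore] -/
theorem le (hF : IsTermFn F) (hG : IsTermFn G) : IsQFDef fun xs => MLe (F xs) (G xs) := by
  obtain ⟨t, ht⟩ := hF
  obtain ⟨s, hs⟩ := hG
  refine ⟨Term.le (t.relabel Sum.inl) (s.relabel Sum.inl), ?_, fun xs => ?_⟩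
  · exact (BoundedFormula.IsAtomic.rel _ _).isQF
  · dsimp only
    rw [ht, hs]
    simp [Formula.Realize]

/-- `F x̄ = G x̄` is open-definable for term functions `F`, `G`. [folklore] -/
theorem eq (hF : IsTermFn F) (hG : IsTermFn G) : IsQFDef fun xs => F xs = G xs := by
  obtain ⟨t, ht⟩ := hF
  obtain ⟨s, hs⟩ := hG
  refine ⟨Term.equal t s, (BoundedFormula.IsAtomic.equal _ _).isQF, fun xs => ?_⟩
  dsimp only
  rw [ht, hs]
  simp

/-- `True` is open-definable. [folklore] -/
theorem top : IsQFDef fun _ : Fin m → M => True :=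
  ⟨⊤, IsQF.top, fun _ => by simp⟩

/-- `False` is open-definable. [folklore] -/
theorem bot : IsQFDef fun _ : Fin m → M => False :=
  ⟨⊥, IsQF.falsum, fun _ => by simp⟩

/-- Open-definable predicates are closed under negation. [folklore] -/
theorem not (hP : IsQFDef P) : IsQFDef fun xs => ¬P xs := by
  obtain ⟨φ, hφ, h⟩ := hP
  exact ⟨∼φ, hφ.not, fun xs => by simp [h]⟩

/-- Open-definable predicates are closed under conjunction. [folklore] -/
theorem and (hP : IsQFDef P) (hQ : IsQFDef Q) : IsQFDef fun xs => P xs ∧ Q xs := by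
  obtain ⟨φ, hφ, h⟩ := hP
  obtain ⟨ψ, hψ, h'⟩ := hQ
  exact ⟨φ ⊓ ψ, hφ.inf hψ, fun xs => by simp [h, h']⟩

/-- Open-definable predicates are closed under disjunction. [folklore] -/
theorem or (hP : IsQFDef P) (hQ : IsQFDef Q) : IsQFDef fun xs => P xs ∨ Q xs := by
  obtain ⟨φ, hφ, h⟩ := hP
  obtain ⟨ψ, hψ, h'⟩ := hQ
  exact ⟨φ ⊔ ψ, hφ.sup hψ, fun xs => by simp [h, h']⟩

/-- Open-definable predicates are closed under implication. [folklore] -/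
theorem imp (hP : IsQFDef P) (hQ : IsQFDef Q) : IsQFDef fun xs => P xs → Q xs := by
  obtain ⟨φ, hφ, h⟩ := hP
  obtain ⟨ψ, hψ, h'⟩ := hQ
  exact ⟨φ ⟹ ψ, hφ.imp hψ, fun xs => by simp [h, h']⟩

/-- Open-definable predicates are closed under bi-implication. [folklore] -/
theorem iff (hP : IsQFDef P) (hQ : IsQFDef Q) : IsQFDef fun xs => (P xs ↔ Q xs) := by
  obtain ⟨φ, hφ, h⟩ := hP
  obtain ⟨ψ, hψ, h'⟩ := hQ
  exact ⟨φ ⇔ ψ, (hφ.imp hψ).inf (hψ.imp hφ), fun xs => by simp [h, h', iff_def]⟩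

/-- Open-definable predicates are closed under renaming of arguments. [folklore] -/
theorem comp {m' : ℕ} {P : (Fin m' → M) → Prop} (hP : IsQFDef P) (g : Fin m' → Fin m) :
    IsQFDef fun xs : Fin m → M => P (xs ∘ g) := by
  obtain ⟨φ, hφ, h⟩ := hP
  refine ⟨φ.relabel (argMap g), hφ.relabel _, fun xs => ?_⟩
  dsimp only
  rw [h, Formula.realize_relabel, argEnv_comp_argMap]

/-- Open-definable predicates are closed under substitution of a term function for the last
argument. [folklore] -/
theorem snoc {P : (Fin (m + 1) → M) → Prop} (hP : IsQFDef P) (hG : IsTermFn G) :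
    IsQFDef fun xs : Fin m → M => P (Fin.snoc xs (G xs)) := by
  obtain ⟨φ, hφ, h⟩ := hP
  obtain ⟨s, hs⟩ := hG
  refine ⟨φ.subst (snocSubst s), isQF_subst hφ _, fun xs => ?_⟩
  dsimp only
  rw [h]
  simp only [Formula.Realize, realize_subst, realize_snocSubst, ← hs]

end IsQFDef

/-! ### `Σᵇᵢ`- and `Πᵇᵢ`-definability: facts valid at every level -/

section Levels

variable {i j : ℕ} {P Q : (Fin m → M) → Prop} {F G : (Fin m → M) → M}

/-- Transfer of term-definability along an extensional equality. [folklore] -/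
theorem IsTermFn.of_eq (hF : IsTermFn F) (h : ∀ xs, F xs = G xs) : IsTermFn G := by
  obtain ⟨t, ht⟩ := hF
  exact ⟨t, fun xs => (h xs).symm.trans (ht xs)⟩

/-- Transfer of open definability along an extensional equivalence. [folklore] -/
theorem IsQFDef.of_iff (hP : IsQFDef P) (h : ∀ xs, P xs ↔ Q xs) : IsQFDef Q := by
  obtain ⟨φ, hφ, hP⟩ := hP
  exact ⟨φ, hφ, fun xs => (h xs).symm.trans (hP xs)⟩

/-- Transfer of `Σᵇᵢ`-definability along an extensional equivalence. [folklore] -/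
theorem IsSigmabDef.of_iff (hP : IsSigmabDef i P) (h : ∀ xs, P xs ↔ Q xs) : IsSigmabDef i Q := by
  obtain ⟨φ, hφ, hP⟩ := hP
  exact ⟨φ, hφ, fun xs => (h xs).symm.trans (hP xs)⟩

/-- Transfer of `Πᵇᵢ`-definability along an extensional equivalence. [folklore] -/
theorem IsPibDef.of_iff (hP : IsPibDef i P) (h : ∀ xs, P xs ↔ Q xs) : IsPibDef i Q := by
  obtain ⟨φ, hφ, hP⟩ := hP
  exact ⟨φ, hφ, fun xs => (h xs).symm.trans (hP xs)⟩

/-- Transfer of `Δᵇᵢ`-definability along an extensional equivalence. [folklore] -/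
theorem IsDeltabDef.of_iff (hP : IsDeltabDef i P) (h : ∀ xs, P xs ↔ Q xs) : IsDeltabDef i Q :=
  ⟨hP.1.of_iff h, hP.2.of_iff h⟩

/-- Open-definable predicates are `Σᵇᵢ`-definable for every `i` (open formulas are sharply
bounded, Buss 1986, §2.1). [cite: Buss1986, §2.1] -/
theorem IsQFDef.isSigmabDef (hP : IsQFDef P) (i : ℕ) : IsSigmabDef i P := by
  obtain ⟨φ, hφ, h⟩ := hP
  exact ⟨φ, .of_isSharplyBounded (.of_isQF hφ), h⟩

/-- Open-definable predicates are `Πᵇᵢ`-definable for every `i` (Buss 1986, §2.1).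
[cite: Buss1986, §2.1] -/
theorem IsQFDef.isPibDef (hP : IsQFDef P) (i : ℕ) : IsPibDef i P := by
  obtain ⟨φ, hφ, h⟩ := hP
  exact ⟨φ, .of_isSharplyBounded (.of_isQF hφ), h⟩

/-- Open-definable predicates are `Δᵇᵢ`-definable for every `i` (Buss 1986, §2.1).
[cite: Buss1986, §2.1] -/
theorem IsQFDef.isDeltabDef (hP : IsQFDef P) (i : ℕ) : IsDeltabDef i P :=
  ⟨hP.isSigmabDef i, hP.isPibDef i⟩

/-- `Πᵇᵢ ⊆ Σᵇᵢ₊₁` for definable predicates (Buss 1986, §2.1). [cite: Buss1986, §2.1] -/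
theorem IsPibDef.isSigmabDef_succ (hP : IsPibDef i P) : IsSigmabDef (i + 1) P := by
  obtain ⟨φ, hφ, h⟩ := hP
  exact ⟨φ, hφ.isSigmab_succ, h⟩

/-- `Σᵇᵢ ⊆ Πᵇᵢ₊₁` for definable predicates (Buss 1986, §2.1). [cite: Buss1986, §2.1] -/
theorem IsSigmabDef.isPibDef_succ (hP : IsSigmabDef i P) : IsPibDef (i + 1) P := by
  obtain ⟨φ, hφ, h⟩ := hP
  exact ⟨φ, hφ.isPib_succ, h⟩

/-- Cumulativity `Σᵇᵢ ⊆ Σᵇⱼ` (`i ≤ j`) for definable predicates (Buss 1986, §2.1).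
[cite: Buss1986, §2.1] -/
theorem IsSigmabDef.mono (hP : IsSigmabDef i P) (hij : i ≤ j) : IsSigmabDef j P := by
  obtain ⟨φ, hφ, h⟩ := hP
  exact ⟨φ, IsSigmab.mono_holds hij hφ, h⟩

/-- Cumulativity `Πᵇᵢ ⊆ Πᵇⱼ` (`i ≤ j`) for definable predicates (Buss 1986, §2.1).
[cite: Buss1986, §2.1] -/
theorem IsPibDef.mono (hP : IsPibDef i P) (hij : i ≤ j) : IsPibDef j P := by
  obtain ⟨φ, hφ, h⟩ := hP
  exact ⟨φ, IsPib.mono_holds hij hφ, h⟩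

/-- Cumulativity for `Δᵇ`-definable predicates (Buss 1986, §2.1). [cite: Buss1986, §2.1] -/
theorem IsDeltabDef.mono (hP : IsDeltabDef i P) (hij : i ≤ j) : IsDeltabDef j P :=
  ⟨hP.1.mono hij, hP.2.mono hij⟩

/-- `Δᵇᵢ ⊆ Σᵇᵢ₊₁ ∩ Πᵇᵢ₊₁`: a `Δᵇᵢ`-definable predicate is `Δᵇᵢ₊₁`-definable. [folklore] -/
theorem IsDeltabDef.succ (hP : IsDeltabDef i P) : IsDeltabDef (i + 1) P :=
  hP.mono (Nat.le_succ i)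

/-- `Σᵇᵢ`-definable predicates are closed under renaming of arguments (Buss 1986, §2.1).
[cite: Buss1986, §2.1] -/
theorem IsSigmabDef.comp {m' : ℕ} {P : (Fin m' → M) → Prop} (hP : IsSigmabDef i P)
    (g : Fin m' → Fin m) : IsSigmabDef i fun xs : Fin m → M => P (xs ∘ g) := by
  obtain ⟨φ, hφ, h⟩ := hP
  refine ⟨φ.relabel (argMap g), hφ.formulaRelabel _, fun xs => ?_⟩
  dsimp only
  rw [h, Formula.realize_relabel, argEnv_comp_argMap]

/-- `Πᵇᵢ`-definable predicates are closed under renaming of arguments (Buss 1986, §2.1).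
[cite: Buss1986, §2.1] -/
theorem IsPibDef.comp {m' : ℕ} {P : (Fin m' → M) → Prop} (hP : IsPibDef i P)
    (g : Fin m' → Fin m) : IsPibDef i fun xs : Fin m → M => P (xs ∘ g) := by
  obtain ⟨φ, hφ, h⟩ := hP
  refine ⟨φ.relabel (argMap g), hφ.formulaRelabel _, fun xs => ?_⟩
  dsimp only
  rw [h, Formula.realize_relabel, argEnv_comp_argMap]

/-- `Δᵇᵢ`-definable predicates are closed under renaming of arguments. [folklore] -/
theorem IsDeltabDef.comp {m' : ℕ} {P : (Fin m' → M) → Prop} (hP : IsDeltabDef i P)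
    (g : Fin m' → Fin m) : IsDeltabDef i fun xs : Fin m → M => P (xs ∘ g) :=
  ⟨hP.1.comp g, hP.2.comp g⟩

/-- `Σᵇᵢ`-definable predicates are closed under substitution of a term function for the last
argument (Buss 1986, §2.1: closure under term substitution). [cite: Buss1986, §2.1] -/
theorem IsSigmabDef.snoc {P : (Fin (m + 1) → M) → Prop} (hP : IsSigmabDef i P)
    (hG : IsTermFn G) : IsSigmabDef i fun xs : Fin m → M => P (Fin.snoc xs (G xs)) := by
  obtain ⟨φ, hφ, h⟩ := hP
  obtain ⟨s, hs⟩ := hG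
  refine ⟨φ.subst (snocSubst s), hφ.subst _, fun xs => ?_⟩
  dsimp only
  rw [h]
  simp only [Formula.Realize, realize_subst, realize_snocSubst, ← hs]

/-- `Πᵇᵢ`-definable predicates are closed under substitution of a term function for the last
argument (Buss 1986, §2.1). [cite: Buss1986, §2.1] -/
theorem IsPibDef.snoc {P : (Fin (m + 1) → M) → Prop} (hP : IsPibDef i P)
    (hG : IsTermFn G) : IsPibDef i fun xs : Fin m → M => P (Fin.snoc xs (G xs)) := by
  obtain ⟨φ, hφ, h⟩ := hP
  obtain ⟨s, hs⟩ := hG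
  refine ⟨φ.subst (snocSubst s), hφ.subst _, fun xs => ?_⟩
  dsimp only
  rw [h]
  simp only [Formula.Realize, realize_subst, realize_snocSubst, ← hs]

/-- `Δᵇᵢ`-definable predicates are closed under substitution of a term function for the last
argument. [folklore] -/
theorem IsDeltabDef.snoc {P : (Fin (m + 1) → M) → Prop} (hP : IsDeltabDef i P)
    (hG : IsTermFn G) : IsDeltabDef i fun xs : Fin m → M => P (Fin.snoc xs (G xs)) :=
  ⟨hP.1.snoc hG, hP.2.snoc hG⟩

end Levels

/-! ### Closure properties at successor levels `Σᵇᵢ₊₁`, `Πᵇᵢ₊₁` -/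

section Succ

variable {i : ℕ} {P Q : (Fin m → M) → Prop}

/-- Negations of `Πᵇᵢ₊₁`-definable predicates are `Σᵇᵢ₊₁`-definable (Buss 1986, §2.1).
[cite: Buss1986, §2.1] -/
theorem IsPibDef.not (hP : IsPibDef (i + 1) P) : IsSigmabDef (i + 1) fun xs => ¬P xs := by
  obtain ⟨φ, hφ, h⟩ := hP
  exact ⟨∼φ, hφ.not, fun xs => by simp [h]⟩

/-- Negations of `Σᵇᵢ₊₁`-definable predicates are `Πᵇᵢ₊₁`-definable (Buss 1986, §2.1).
[cite: Buss1986, §2.1] -/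
theorem IsSigmabDef.not (hP : IsSigmabDef (i + 1) P) : IsPibDef (i + 1) fun xs => ¬P xs := by
  obtain ⟨φ, hφ, h⟩ := hP
  exact ⟨∼φ, hφ.not, fun xs => by simp [h]⟩

/-- `Δᵇᵢ₊₁`-definable predicates are closed under negation. [folklore] -/
theorem IsDeltabDef.not (hP : IsDeltabDef (i + 1) P) : IsDeltabDef (i + 1) fun xs => ¬P xs :=
  ⟨hP.2.not, hP.1.not⟩

/-- `Σᵇᵢ₊₁`-definable predicates are closed under conjunction (Buss 1986, §2.1).
[cite: Buss1986, §2.1] -/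
theorem IsSigmabDef.and (hP : IsSigmabDef (i + 1) P) (hQ : IsSigmabDef (i + 1) Q) :
    IsSigmabDef (i + 1) fun xs => P xs ∧ Q xs := by
  obtain ⟨φ, hφ, h⟩ := hP
  obtain ⟨ψ, hψ, h'⟩ := hQ
  exact ⟨φ ⊓ ψ, hφ.inf hψ, fun xs => by simp [h, h']⟩

/-- `Σᵇᵢ₊₁`-definable predicates are closed under disjunction (Buss 1986, §2.1).
[cite: Buss1986, §2.1] -/
theorem IsSigmabDef.or (hP : IsSigmabDef (i + 1) P) (hQ : IsSigmabDef (i + 1) Q) :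
    IsSigmabDef (i + 1) fun xs => P xs ∨ Q xs := by
  obtain ⟨φ, hφ, h⟩ := hP
  obtain ⟨ψ, hψ, h'⟩ := hQ
  exact ⟨φ ⊔ ψ, hφ.sup hψ, fun xs => by simp [h, h']⟩

/-- `Πᵇᵢ₊₁`-definable predicates are closed under conjunction (Buss 1986, §2.1).
[cite: Buss1986, §2.1] -/
theorem IsPibDef.and (hP : IsPibDef (i + 1) P) (hQ : IsPibDef (i + 1) Q) :
    IsPibDef (i + 1) fun xs => P xs ∧ Q xs := by
  obtain ⟨φ, hφ, h⟩ := hP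
  obtain ⟨ψ, hψ, h'⟩ := hQ
  exact ⟨φ ⊓ ψ, (IsSigmab.imp hφ hψ.not).not, fun xs => by simp [h, h']⟩

/-- `Πᵇᵢ₊₁`-definable predicates are closed under disjunction (Buss 1986, §2.1).
[cite: Buss1986, §2.1] -/
theorem IsPibDef.or (hP : IsPibDef (i + 1) P) (hQ : IsPibDef (i + 1) Q) :
    IsPibDef (i + 1) fun xs => P xs ∨ Q xs := by
  obtain ⟨φ, hφ, h⟩ := hP
  obtain ⟨ψ, hψ, h'⟩ := hQ
  exact ⟨φ ⊔ ψ, IsPib.imp hφ.not hψ, fun xs => by simp [h, h']⟩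

/-- An implication `P → Q` with `P ∈ Πᵇᵢ₊₁`, `Q ∈ Σᵇᵢ₊₁` is `Σᵇᵢ₊₁`-definable (Buss 1986, §2.1).
[cite: Buss1986, §2.1] -/
theorem IsSigmabDef.imp (hP : IsPibDef (i + 1) P) (hQ : IsSigmabDef (i + 1) Q) :
    IsSigmabDef (i + 1) fun xs => P xs → Q xs := by
  obtain ⟨φ, hφ, h⟩ := hP
  obtain ⟨ψ, hψ, h'⟩ := hQ
  exact ⟨φ ⟹ ψ, .imp hφ hψ, fun xs => by simp [h, h']⟩

/-- An implication `P → Q` with `P ∈ Σᵇᵢ₊₁`, `Q ∈ Πᵇᵢ₊₁` is `Πᵇᵢ₊₁`-definable (Buss 1986, §2.1).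
[cite: Buss1986, §2.1] -/
theorem IsPibDef.imp (hP : IsSigmabDef (i + 1) P) (hQ : IsPibDef (i + 1) Q) :
    IsPibDef (i + 1) fun xs => P xs → Q xs := by
  obtain ⟨φ, hφ, h⟩ := hP
  obtain ⟨ψ, hψ, h'⟩ := hQ
  exact ⟨φ ⟹ ψ, .imp hφ hψ, fun xs => by simp [h, h']⟩

/-- `Δᵇᵢ₊₁`-definable predicates are closed under conjunction. [folklore] -/
theorem IsDeltabDef.and (hP : IsDeltabDef (i + 1) P) (hQ : IsDeltabDef (i + 1) Q) :
    IsDeltabDef (i + 1) fun xs => P xs ∧ Q xs :=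
  ⟨hP.1.and hQ.1, hP.2.and hQ.2⟩

/-- `Δᵇᵢ₊₁`-definable predicates are closed under disjunction. [folklore] -/
theorem IsDeltabDef.or (hP : IsDeltabDef (i + 1) P) (hQ : IsDeltabDef (i + 1) Q) :
    IsDeltabDef (i + 1) fun xs => P xs ∨ Q xs :=
  ⟨hP.1.or hQ.1, hP.2.or hQ.2⟩

/-- `Δᵇᵢ₊₁`-definable predicates are closed under implication. [folklore] -/
theorem IsDeltabDef.imp (hP : IsDeltabDef (i + 1) P) (hQ : IsDeltabDef (i + 1) Q) :
    IsDeltabDef (i + 1) fun xs => P xs → Q xs :=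
  ⟨hQ.1.imp hP.2, hQ.2.imp hP.1⟩

/-- `Δᵇᵢ₊₁`-definable predicates are closed under bi-implication. [folklore] -/
theorem IsDeltabDef.iff (hP : IsDeltabDef (i + 1) P) (hQ : IsDeltabDef (i + 1) Q) :
    IsDeltabDef (i + 1) fun xs => (P xs ↔ Q xs) :=
  ((hP.imp hQ).and (hQ.imp hP)).of_iff fun _ => iff_def.symm

variable {R : (Fin (m + 1) → M) → Prop} {B : (Fin m → M) → M}

/-- **Bounded `∃`.** `Σᵇᵢ₊₁`-definable predicates are closed under bounded existential
quantification `∃ y ≤ t(x̄)` with `t` a term (Buss 1986, §2.1). [cite: Buss1986, §2.1] -/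
theorem IsSigmabDef.bexLE (hR : IsSigmabDef (i + 1) R) (hB : IsTermFn B) :
    IsSigmabDef (i + 1) fun xs => ∃ y, MLe y (B xs) ∧ R (Fin.snoc xs y) := by
  obtain ⟨φ, hφ, h⟩ := hR
  obtain ⟨t, ht⟩ := hB
  refine ⟨MetaComplexity.bexLE (t.relabel Sum.inl) (BoundedFormula.relabel bindLast φ),
    .bexLE _ (hφ.relabel _),
    fun xs => ?_⟩
  dsimp only
  simp only [Formula.Realize, realize_bexLE', Term.realize_relabel, Sum.elim_comp_inl, ← ht]
  refine exists_congr fun y => and_congr_right fun _ => ?_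
  rw [h, ← realize_relabel_bindLast φ xs y]

/-- **Bounded `∀`.** `Πᵇᵢ₊₁`-definable predicates are closed under bounded universal
quantification `∀ y ≤ t(x̄)` (Buss 1986, §2.1). [cite: Buss1986, §2.1] -/
theorem IsPibDef.ballLE (hR : IsPibDef (i + 1) R) (hB : IsTermFn B) :
    IsPibDef (i + 1) fun xs => ∀ y, MLe y (B xs) → R (Fin.snoc xs y) := by
  obtain ⟨φ, hφ, h⟩ := hR
  obtain ⟨t, ht⟩ := hB
  refine ⟨MetaComplexity.ballLE (t.relabel Sum.inl) (BoundedFormula.relabel bindLast φ),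
    .ballLE _ (hφ.relabel _),
    fun xs => ?_⟩
  dsimp only
  simp only [Formula.Realize, realize_ballLE', Term.realize_relabel, Sum.elim_comp_inl, ← ht]
  refine forall_congr' fun y => imp_congr_right fun _ => ?_
  rw [h, ← realize_relabel_bindLast φ xs y]

/-- **Sharply bounded `∀`.** `Σᵇᵢ₊₁`-definable predicates are closed under sharply bounded
universal quantification `∀ y ≤ |t(x̄)|` (Buss 1986, §2.1). [cite: Buss1986, §2.1] -/
theorem IsSigmabDef.ballLELen (hR : IsSigmabDef (i + 1) R) (hB : IsTermFn B) :
    IsSigmabDef (i + 1) fun xs => ∀ y, MLe y (mLen (B xs)) → R (Fin.snoc xs y) := by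
  obtain ⟨φ, hφ, h⟩ := hR
  obtain ⟨t, ht⟩ := hB
  refine ⟨MetaComplexity.ballLELen (t.relabel Sum.inl) (BoundedFormula.relabel bindLast φ),
    .ballLELen _ (hφ.relabel _),
    fun xs => ?_⟩
  dsimp only
  simp only [MetaComplexity.ballLELen, Formula.Realize, realize_ballLE', realize_term_len,
    Term.realize_relabel, Sum.elim_comp_inl, ← ht]
  refine forall_congr' fun y => imp_congr_right fun _ => ?_
  rw [h, ← realize_relabel_bindLast φ xs y]

/-- **Sharply bounded `∃`.** `Πᵇᵢ₊₁`-definable predicates are closed under sharply bounded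
existential quantification `∃ y ≤ |t(x̄)|` (Buss 1986, §2.1). [cite: Buss1986, §2.1] -/
theorem IsPibDef.bexLELen (hR : IsPibDef (i + 1) R) (hB : IsTermFn B) :
    IsPibDef (i + 1) fun xs => ∃ y, MLe y (mLen (B xs)) ∧ R (Fin.snoc xs y) := by
  obtain ⟨φ, hφ, h⟩ := hR
  obtain ⟨t, ht⟩ := hB
  refine ⟨MetaComplexity.bexLELen (t.relabel Sum.inl) (BoundedFormula.relabel bindLast φ),
    .bexLELen _ (hφ.relabel _),
    fun xs => ?_⟩
  dsimp only
  simp only [MetaComplexity.bexLELen, Formula.Realize, realize_bexLE', realize_term_len,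
    Term.realize_relabel, Sum.elim_comp_inl, ← ht]
  refine exists_congr fun y => and_congr_right fun _ => ?_
  rw [h, ← realize_relabel_bindLast φ xs y]

/-- Sharply bounded `∃` for `Σᵇᵢ₊₁` (a special case of bounded `∃`). [folklore] -/
theorem IsSigmabDef.bexLELen (hR : IsSigmabDef (i + 1) R) (hB : IsTermFn B) :
    IsSigmabDef (i + 1) fun xs => ∃ y, MLe y (mLen (B xs)) ∧ R (Fin.snoc xs y) :=
  hR.bexLE hB.len

/-- Sharply bounded `∀` for `Πᵇᵢ₊₁` (a special case of bounded `∀`). [folklore] -/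
theorem IsPibDef.ballLELen (hR : IsPibDef (i + 1) R) (hB : IsTermFn B) :
    IsPibDef (i + 1) fun xs => ∀ y, MLe y (mLen (B xs)) → R (Fin.snoc xs y) :=
  hR.ballLE hB.len

/-- `Δᵇᵢ₊₁`-definable predicates are closed under sharply bounded `∀`. [folklore] -/
theorem IsDeltabDef.ballLELen (hR : IsDeltabDef (i + 1) R) (hB : IsTermFn B) :
    IsDeltabDef (i + 1) fun xs => ∀ y, MLe y (mLen (B xs)) → R (Fin.snoc xs y) :=
  ⟨hR.1.ballLELen hB, hR.2.ballLELen hB⟩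

/-- `Δᵇᵢ₊₁`-definable predicates are closed under sharply bounded `∃`. [folklore] -/
theorem IsDeltabDef.bexLELen (hR : IsDeltabDef (i + 1) R) (hB : IsTermFn B) :
    IsDeltabDef (i + 1) fun xs => ∃ y, MLe y (mLen (B xs)) ∧ R (Fin.snoc xs y) :=
  ⟨hR.1.bexLELen hB, hR.2.bexLELen hB⟩

end Succ

/-! ### Definable functions and substitution -/

section Functions

variable {i : ℕ} {F G : (Fin m → M) → M}

/-- The graph of `F : Mᵐ → M` as an `(m+1)`-ary predicate (last coordinate = value). [folklore] -/
def graphPred (F : (Fin m → M) → M) (v : Fin (m + 1) → M) : Prop :=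
  v (Fin.last m) = F (Fin.init v)

omit [Language.boundedArith.Structure M] in
/-- The graph predicate at an extended tuple. [folklore] -/
@[simp] theorem graphPred_snoc (F : (Fin m → M) → M) (xs : Fin m → M) (y : M) :
    graphPred F (Fin.snoc xs y) ↔ y = F xs := by
  simp [graphPred]

/-- `IsBoundedFn F`: the values of `F` are bounded by a term with parameters,
`F(x̄) ≤ t(x̄)` (Buss 1986, §2.2: the bounding term of a `Σᵇ₁`-defined function).
[cite: Buss1986, §2.2] -/
def IsBoundedFn (F : (Fin m → M) → M) : Prop :=
  ∃ B : (Fin m → M) → M, IsTermFn B ∧ ∀ xs, MLe (F xs) (B xs)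

/-- `IsSigmabFn i F`: the function `F : Mᵐ → M` has a `Σᵇᵢ`-definable graph (with parameters)
and is bounded by a term — the semantic counterpart, in a fixed structure, of a function
`Σᵇᵢ`-defined by a theory (Buss 1986, §2.2, Definition; Krajíček 1995, §5.2).
[cite: Buss1986, §2.2] -/
structure IsSigmabFn (i : ℕ) (F : (Fin m → M) → M) : Prop where
  /-- The graph `y = F(x̄)` is `Σᵇᵢ`-definable with parameters. -/
  graph : IsSigmabDef i (graphPred F)
  /-- `F` is bounded by a term with parameters. -/
  bounded : IsBoundedFn F

/-- Transfer of `IsSigmabFn` along an extensional equality. [folklore] -/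
theorem IsSigmabFn.of_eq (hF : IsSigmabFn i F) (h : ∀ xs, F xs = G xs) : IsSigmabFn i G := by
  refine ⟨hF.graph.of_iff fun v => by rw [graphPred, graphPred, h], ?_⟩
  obtain ⟨B, hB, hFB⟩ := hF.bounded
  exact ⟨B, hB, fun xs => h xs ▸ hFB xs⟩

/-- Cumulativity for `Σᵇ`-definable functions. [folklore] -/
theorem IsSigmabFn.mono {j : ℕ} (hF : IsSigmabFn i F) (hij : i ≤ j) : IsSigmabFn j F :=
  ⟨hF.graph.mono hij, hF.bounded⟩

/-- A term function is a `Σᵇᵢ`-definable function, in any structure in which `≤` is reflexive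
(e.g. a model of `BASIC`). [folklore] -/
theorem IsTermFn.isSigmabFn (hF : IsTermFn F) (hrefl : ∀ a : M, MLe a a) (i : ℕ) :
    IsSigmabFn i F := by
  refine ⟨?_, F, hF, fun xs => hrefl _⟩
  have h : IsQFDef (graphPred F) :=
    (IsQFDef.eq (IsTermFn.proj (Fin.last m)) (hF.comp Fin.castSucc)).of_iff fun v => Iff.rfl
  exact h.isSigmabDef i

/-- The graph of a `Σᵇᵢ₊₁`-definable function is also `Πᵇᵢ₊₁`-definable:
`y = F(x̄) ↔ ∀ z ≤ t(x̄) (z = F(x̄) → y = z)`, using the bounding term `t`. [folklore] -/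
theorem IsSigmabFn.isPibDef_graph (hF : IsSigmabFn (i + 1) F) :
    IsPibDef (i + 1) (graphPred F) := by
  obtain ⟨B, hB, hFB⟩ := hF.bounded
  -- the graph with a dummy penultimate coordinate: `w ↦ w_{m+1} = F(w₀,…,w_{m-1})`
  let g : Fin (m + 1) → Fin (m + 2) :=
    Fin.snoc (α := fun _ => Fin (m + 2)) (fun k => k.castSucc.castSucc) (Fin.last (m + 1))
  have hg : IsSigmabDef (i + 1) fun w : Fin (m + 2) → M =>
      w (Fin.last (m + 1)) = F (Fin.init (Fin.init w)) := by
    refine (hF.graph.comp g).of_iff fun w => ?_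
    have h1 : (w ∘ g) (Fin.last m) = w (Fin.last (m + 1)) := by simp [g]
    have h2 : Fin.init (w ∘ g) = Fin.init (Fin.init w) := by
      funext k
      simp [g, Fin.init]
    simp only [graphPred, h1, h2]
  have hR : IsPibDef (i + 1) fun w : Fin (m + 2) → M =>
      w (Fin.last (m + 1)) = F (Fin.init (Fin.init w)) →
        w (Fin.castSucc (Fin.last m)) = w (Fin.last (m + 1)) :=
    IsPibDef.imp hg ((IsQFDef.eq (IsTermFn.proj _) (IsTermFn.proj _)).isPibDef _)
  refine (hR.ballLE (hB.comp Fin.castSucc)).of_iff fun v => ?_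
  simp only [Fin.snoc_last, Fin.init_snoc, Fin.snoc_castSucc, graphPred]
  constructor
  · intro h
    exact h (F (Fin.init v)) (hFB _) rfl
  · intro h y _ hy
    rw [h, hy]


/-- A `Σᵇ`-definable function given by a `Σᵇᵢ`-definable functional relation `R(x̄, y)`:
if `F` selects the unique `y` with `R(x̄, y)` and is bounded by a term, then `F` is
`Σᵇᵢ`-definable (Buss 1986, §2.2: definition of a function by a provably functional `Σᵇ₁`
formula). [cite: Buss1986, §2.2] -/
theorem IsSigmabFn.of_unique {R : (Fin (m + 1) → M) → Prop} (hR : IsSigmabDef i R)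
    (hF : ∀ xs, R (Fin.snoc xs (F xs))) (huniq : ∀ xs y, R (Fin.snoc xs y) → y = F xs)
    (hbd : IsBoundedFn F) : IsSigmabFn i F := by
  refine ⟨hR.of_iff fun v => ?_, hbd⟩
  constructor
  · intro h
    have h' : R (Fin.snoc (Fin.init v) (v (Fin.last m))) := by rwa [Fin.snoc_init_self]
    exact huniq (Fin.init v) (v (Fin.last m)) h'
  · intro h
    rw [graphPred] at h
    have := hF (Fin.init v)
    rwa [← h, Fin.snoc_init_self] at this

/-- `Σᵇ`-definable functions are closed under renaming of arguments. [folklore] -/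
theorem IsSigmabFn.comp {m' : ℕ} {F : (Fin m' → M) → M} (hF : IsSigmabFn i F)
    (g : Fin m' → Fin m) : IsSigmabFn i fun xs : Fin m → M => F (xs ∘ g) := by
  refine ⟨?_, ?_⟩
  · let g' : Fin (m' + 1) → Fin (m + 1) :=
      Fin.snoc (α := fun _ => Fin (m + 1)) (fun k => (g k).castSucc) (Fin.last m)
    refine (hF.graph.comp g').of_iff fun v => ?_
    have h1 : (v ∘ g') (Fin.last m') = v (Fin.last m) := by simp [g']
    have h2 : Fin.init (v ∘ g') = Fin.init v ∘ g := by
      funext k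
      simp [g', Fin.init]
    simp only [graphPred, h1, h2]
  · obtain ⟨B, hB, hFB⟩ := hF.bounded
    exact ⟨fun xs => B (xs ∘ g), hB.comp g, fun xs => hFB _⟩

variable {R : (Fin (m + 1) → M) → Prop}

/-- **Substitution of a `Σᵇᵢ₊₁`-definable function into a `Σᵇᵢ₊₁` predicate**:
`R(x̄, F(x̄)) ↔ ∃ y ≤ t(x̄) (y = F(x̄) ∧ R(x̄, y))` (Buss 1986, §2.2, Thm. 2.2: formulas of the
extended language by `Σᵇ₁`-defined function symbols are equivalent to formulas of the same
class). [cite: Buss1986, §2.2, Thm. 2.2] -/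
theorem IsSigmabDef.snocFn (hR : IsSigmabDef (i + 1) R) (hF : IsSigmabFn (i + 1) F) :
    IsSigmabDef (i + 1) fun xs => R (Fin.snoc xs (F xs)) := by
  obtain ⟨B, hB, hFB⟩ := hF.bounded
  refine ((hF.graph.and hR).bexLE hB).of_iff fun xs => ?_
  simp only [graphPred_snoc]
  constructor
  · rintro ⟨y, -, rfl, hy⟩
    exact hy
  · intro hxs
    exact ⟨F xs, hFB xs, rfl, hxs⟩

/-- **Substitution of a `Σᵇᵢ₊₁`-definable function into a `Πᵇᵢ₊₁` predicate**:
`R(x̄, F(x̄)) ↔ ∀ y ≤ t(x̄) (y = F(x̄) → R(x̄, y))` (Buss 1986, §2.2, Thm. 2.2).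
[cite: Buss1986, §2.2, Thm. 2.2] -/
theorem IsPibDef.snocFn (hR : IsPibDef (i + 1) R) (hF : IsSigmabFn (i + 1) F) :
    IsPibDef (i + 1) fun xs => R (Fin.snoc xs (F xs)) := by
  obtain ⟨B, hB, hFB⟩ := hF.bounded
  refine ((IsPibDef.imp hF.graph hR).ballLE hB).of_iff fun xs => ?_
  simp only [graphPred_snoc]
  constructor
  · intro h
    exact h (F xs) (hFB xs) rfl
  · rintro hxs y - rfl
    exact hxs

/-- Substitution of a `Σᵇᵢ₊₁`-definable function into a `Δᵇᵢ₊₁` predicate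
(Buss 1986, §2.2, Thm. 2.2). [cite: Buss1986, §2.2, Thm. 2.2] -/
theorem IsDeltabDef.snocFn (hR : IsDeltabDef (i + 1) R) (hF : IsSigmabFn (i + 1) F) :
    IsDeltabDef (i + 1) fun xs => R (Fin.snoc xs (F xs)) :=
  ⟨hR.1.snocFn hF, hR.2.snocFn hF⟩
end Functions



/-! ### Substituting term functions at small arities

Predicates and functions of one, two or three variables are written `fun v => P (v 0)`,
`fun w => P (w 0) (w 1)`, …; the following lemmas substitute term functions (and definable
functions) for their arguments. -/

section SmallArity

variable {i : ℕ}

/-- A class `C` of predicates (one for each arity) closed under extensional equivalence,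
renaming of arguments and substitution of term functions — e.g. `IsQFDef`, `IsSigmabDef i`,
`IsPibDef i`, `IsDeltabDef i`. [folklore] -/
structure ClosedUnderTermSubst (C : ∀ {m : ℕ}, ((Fin m → M) → Prop) → Prop) : Prop where
  /-- closure under extensional equivalence -/
  of_iff : ∀ {m : ℕ} {P Q : (Fin m → M) → Prop}, C P → (∀ xs, P xs ↔ Q xs) → C Q
  /-- closure under renaming of arguments -/
  comp : ∀ {m m' : ℕ} {P : (Fin m' → M) → Prop}, C P → ∀ g : Fin m' → Fin m,
    C fun xs : Fin m → M => P (xs ∘ g)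
  /-- closure under substitution of a term function for the last argument -/
  snoc : ∀ {m : ℕ} {P : (Fin (m + 1) → M) → Prop} {G : (Fin m → M) → M}, C P → IsTermFn G →
    C fun xs : Fin m → M => P (Fin.snoc xs (G xs))

/-- `IsQFDef` is closed under term substitution. [folklore] -/
theorem closedUnderTermSubst_isQFDef : ClosedUnderTermSubst (M := M) IsQFDef :=
  ⟨IsQFDef.of_iff, IsQFDef.comp, IsQFDef.snoc⟩

/-- `IsSigmabDef i` is closed under term substitution. [folklore] -/
theorem closedUnderTermSubst_isSigmabDef (i : ℕ) :
    ClosedUnderTermSubst (M := M) (IsSigmabDef i) :=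
  ⟨IsSigmabDef.of_iff, IsSigmabDef.comp, IsSigmabDef.snoc⟩

/-- `IsPibDef i` is closed under term substitution. [folklore] -/
theorem closedUnderTermSubst_isPibDef (i : ℕ) : ClosedUnderTermSubst (M := M) (IsPibDef i) :=
  ⟨IsPibDef.of_iff, IsPibDef.comp, IsPibDef.snoc⟩

/-- `IsDeltabDef i` is closed under term substitution. [folklore] -/
theorem closedUnderTermSubst_isDeltabDef (i : ℕ) :
    ClosedUnderTermSubst (M := M) (IsDeltabDef i) :=
  ⟨IsDeltabDef.of_iff, IsDeltabDef.comp, IsDeltabDef.snoc⟩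

namespace ClosedUnderTermSubst

variable {C : ∀ {m : ℕ}, ((Fin m → M) → Prop) → Prop} (hC : ClosedUnderTermSubst (M := M) C)
include hC

/-- Substituting a term function into a unary predicate of the class. [folklore] -/
theorem comp₁ {P : M → Prop} (hP : C fun v : Fin 1 → M => P (v 0)) {F : (Fin m → M) → M}
    (hF : IsTermFn F) : C fun xs => P (F xs) := by
  have h := hC.snoc (hC.comp hP fun _ : Fin 1 => Fin.last m) hF
  exact hC.of_iff h fun xs => by simp

/-- Substituting term functions into a binary predicate of the class. [folklore] -/
theorem comp₂ {P : M → M → Prop} (hP : C fun w : Fin 2 → M => P (w 0) (w 1))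
    {F G : (Fin m → M) → M} (hF : IsTermFn F) (hG : IsTermFn G) :
    C fun xs => P (F xs) (G xs) := by
  -- `u ↦ P (u m) (u (m+1))` on `Fin (m+2)`
  have h1 := hC.comp hP ![Fin.castSucc (Fin.last m), Fin.last (m + 1)]
  -- substitute `G ∘ init` for the last argument: `u' ↦ P (u' m) (G (init u'))`
  have h2 := hC.snoc h1 (hG.comp Fin.castSucc)
  -- substitute `F` for the (new) last argument
  have h3 := hC.snoc h2 hF
  refine hC.of_iff h3 fun xs => ?_
  simp [Function.comp_def]

/-- Substituting term functions into a ternary predicate of the class. [folklore] -/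
theorem comp₃ {P : M → M → M → Prop} (hP : C fun w : Fin 3 → M => P (w 0) (w 1) (w 2))
    {F G H : (Fin m → M) → M} (hF : IsTermFn F) (hG : IsTermFn G) (hH : IsTermFn H) :
    C fun xs => P (F xs) (G xs) (H xs) := by
  have h1 := hC.comp hP
    ![Fin.castSucc (Fin.castSucc (Fin.last m)), Fin.castSucc (Fin.last (m + 1)),
      Fin.last (m + 2)]
  have h2 := hC.snoc h1 ((hH.comp Fin.castSucc).comp Fin.castSucc)
  have h3 := hC.snoc h2 (hG.comp Fin.castSucc)
  have h4 := hC.snoc h3 hF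
  refine hC.of_iff h4 fun xs => ?_
  simp [Function.comp_def]

/-- Substituting term functions into a quaternary predicate of the class. [folklore] -/
theorem comp₄ {P : M → M → M → M → Prop}
    (hP : C fun w : Fin 4 → M => P (w 0) (w 1) (w 2) (w 3))
    {F G H K : (Fin m → M) → M} (hF : IsTermFn F) (hG : IsTermFn G) (hH : IsTermFn H)
    (hK : IsTermFn K) : C fun xs => P (F xs) (G xs) (H xs) (K xs) := by
  have h1 := hC.comp hP
    ![Fin.castSucc (Fin.castSucc (Fin.castSucc (Fin.last m))),
      Fin.castSucc (Fin.castSucc (Fin.last (m + 1))), Fin.castSucc (Fin.last (m + 2)),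
      Fin.last (m + 3)]
  have h2 := hC.snoc h1 (((hK.comp Fin.castSucc).comp Fin.castSucc).comp Fin.castSucc)
  have h3 := hC.snoc h2 ((hH.comp Fin.castSucc).comp Fin.castSucc)
  have h4 := hC.snoc h3 (hG.comp Fin.castSucc)
  have h5 := hC.snoc h4 hF
  refine hC.of_iff h5 fun xs => ?_
  simp [Function.comp_def]

end ClosedUnderTermSubst

variable {F G H : (Fin m → M) → M}

/-- Substituting a term function into a unary `Σᵇᵢ`-definable predicate. [folklore] -/
theorem IsSigmabDef.comp₁ {P : M → Prop} (hP : IsSigmabDef i fun v : Fin 1 → M => P (v 0))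
    (hF : IsTermFn F) : IsSigmabDef i fun xs => P (F xs) :=
  (closedUnderTermSubst_isSigmabDef i).comp₁ hP hF

/-- Substituting term functions into a binary `Σᵇᵢ`-definable predicate. [folklore] -/
theorem IsSigmabDef.comp₂ {P : M → M → Prop}
    (hP : IsSigmabDef i fun w : Fin 2 → M => P (w 0) (w 1)) (hF : IsTermFn F) (hG : IsTermFn G) :
    IsSigmabDef i fun xs => P (F xs) (G xs) :=
  (closedUnderTermSubst_isSigmabDef i).comp₂ hP hF hG

/-- Substituting term functions into a ternary `Σᵇᵢ`-definable predicate. [folklore] -/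
theorem IsSigmabDef.comp₃ {P : M → M → M → Prop}
    (hP : IsSigmabDef i fun w : Fin 3 → M => P (w 0) (w 1) (w 2)) (hF : IsTermFn F)
    (hG : IsTermFn G) (hH : IsTermFn H) : IsSigmabDef i fun xs => P (F xs) (G xs) (H xs) :=
  (closedUnderTermSubst_isSigmabDef i).comp₃ hP hF hG hH

/-- Substituting a term function into a unary `Πᵇᵢ`-definable predicate. [folklore] -/
theorem IsPibDef.comp₁ {P : M → Prop} (hP : IsPibDef i fun v : Fin 1 → M => P (v 0))
    (hF : IsTermFn F) : IsPibDef i fun xs => P (F xs) :=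
  (closedUnderTermSubst_isPibDef i).comp₁ hP hF

/-- Substituting term functions into a binary `Πᵇᵢ`-definable predicate. [folklore] -/
theorem IsPibDef.comp₂ {P : M → M → Prop} (hP : IsPibDef i fun w : Fin 2 → M => P (w 0) (w 1))
    (hF : IsTermFn F) (hG : IsTermFn G) : IsPibDef i fun xs => P (F xs) (G xs) :=
  (closedUnderTermSubst_isPibDef i).comp₂ hP hF hG

/-- Substituting term functions into a ternary `Πᵇᵢ`-definable predicate. [folklore] -/
theorem IsPibDef.comp₃ {P : M → M → M → Prop}
    (hP : IsPibDef i fun w : Fin 3 → M => P (w 0) (w 1) (w 2)) (hF : IsTermFn F)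
    (hG : IsTermFn G) (hH : IsTermFn H) : IsPibDef i fun xs => P (F xs) (G xs) (H xs) :=
  (closedUnderTermSubst_isPibDef i).comp₃ hP hF hG hH

/-- Substituting a term function into a unary `Δᵇᵢ`-definable predicate. [folklore] -/
theorem IsDeltabDef.comp₁ {P : M → Prop} (hP : IsDeltabDef i fun v : Fin 1 → M => P (v 0))
    (hF : IsTermFn F) : IsDeltabDef i fun xs => P (F xs) :=
  (closedUnderTermSubst_isDeltabDef i).comp₁ hP hF

/-- Substituting term functions into a binary `Δᵇᵢ`-definable predicate. [folklore] -/
theorem IsDeltabDef.comp₂ {P : M → M → Prop}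
    (hP : IsDeltabDef i fun w : Fin 2 → M => P (w 0) (w 1)) (hF : IsTermFn F) (hG : IsTermFn G) :
    IsDeltabDef i fun xs => P (F xs) (G xs) :=
  (closedUnderTermSubst_isDeltabDef i).comp₂ hP hF hG

/-- Substituting term functions into a ternary `Δᵇᵢ`-definable predicate. [folklore] -/
theorem IsDeltabDef.comp₃ {P : M → M → M → Prop}
    (hP : IsDeltabDef i fun w : Fin 3 → M => P (w 0) (w 1) (w 2)) (hF : IsTermFn F)
    (hG : IsTermFn G) (hH : IsTermFn H) : IsDeltabDef i fun xs => P (F xs) (G xs) (H xs) :=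
  (closedUnderTermSubst_isDeltabDef i).comp₃ hP hF hG hH

/-- Substituting a term function into a unary open-definable predicate. [folklore] -/
theorem IsQFDef.comp₁ {P : M → Prop} (hP : IsQFDef fun v : Fin 1 → M => P (v 0))
    (hF : IsTermFn F) : IsQFDef fun xs => P (F xs) :=
  closedUnderTermSubst_isQFDef.comp₁ hP hF

/-- Substituting term functions into a binary open-definable predicate. [folklore] -/
theorem IsQFDef.comp₂ {P : M → M → Prop} (hP : IsQFDef fun w : Fin 2 → M => P (w 0) (w 1))
    (hF : IsTermFn F) (hG : IsTermFn G) : IsQFDef fun xs => P (F xs) (G xs) :=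
  closedUnderTermSubst_isQFDef.comp₂ hP hF hG

/-- Substituting term functions into a ternary open-definable predicate. [folklore] -/
theorem IsQFDef.comp₃ {P : M → M → M → Prop}
    (hP : IsQFDef fun w : Fin 3 → M => P (w 0) (w 1) (w 2)) (hF : IsTermFn F)
    (hG : IsTermFn G) (hH : IsTermFn H) : IsQFDef fun xs => P (F xs) (G xs) (H xs) :=
  closedUnderTermSubst_isQFDef.comp₃ hP hF hG hH

/-- Substituting a term function into a unary term function. [folklore] -/
theorem IsTermFn.comp₁ {f : M → M} (hf : IsTermFn fun v : Fin 1 → M => f (v 0))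
    (hF : IsTermFn F) : IsTermFn fun xs => f (F xs) := by
  have h := (hf.comp fun _ : Fin 1 => Fin.last m).snoc hF
  exact h.of_eq fun xs => by simp

/-- Substituting term functions into a binary term function. [folklore] -/
theorem IsTermFn.comp₂ {f : M → M → M} (hf : IsTermFn fun w : Fin 2 → M => f (w 0) (w 1))
    (hF : IsTermFn F) (hG : IsTermFn G) : IsTermFn fun xs => f (F xs) (G xs) := by
  have h1 := hf.comp ![Fin.castSucc (Fin.last m), Fin.last (m + 1)]
  have h2 := h1.snoc (hG.comp Fin.castSucc)
  have h3 := h2.snoc hF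
  exact h3.of_eq fun xs => by simp [Function.comp_def]

/-- Substituting a term function into a unary `Σᵇ`-definable function. [folklore] -/
theorem IsSigmabFn.comp₁ {f : M → M} (hf : IsSigmabFn i fun v : Fin 1 → M => f (v 0))
    (hF : IsTermFn F) : IsSigmabFn i fun xs => f (F xs) := by
  refine ⟨?_, ?_⟩
  · have hg : IsSigmabDef i fun w : Fin 2 → M => w 1 = f (w 0) :=
      hf.graph.of_iff fun w => by simp [graphPred, Fin.init]
    exact (IsSigmabDef.comp₂ (P := fun a b => b = f a) hg (hF.comp Fin.castSucc)
      (IsTermFn.proj (Fin.last m))).of_iff fun v => by simp [graphPred]; rfl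
  · obtain ⟨B, hB, hfB⟩ := hf.bounded
    have hB' : IsTermFn fun v : Fin 1 → M => B ![v 0] :=
      hB.of_eq fun v => by
        congr 1
        ext j
        fin_cases j
        rfl
    exact ⟨fun xs => B ![F xs], hB'.comp₁ (f := fun a => B ![a]) hF,
      fun xs => by simpa using hfB ![F xs]⟩

/-- Substituting term functions into a binary `Σᵇ`-definable function. [folklore] -/
theorem IsSigmabFn.comp₂ {f : M → M → M} (hf : IsSigmabFn i fun w : Fin 2 → M => f (w 0) (w 1))
    (hF : IsTermFn F) (hG : IsTermFn G) : IsSigmabFn i fun xs => f (F xs) (G xs) := by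
  refine ⟨?_, ?_⟩
  · have hg : IsSigmabDef i fun w : Fin 3 → M => w 2 = f (w 0) (w 1) :=
      hf.graph.of_iff fun w => by simp [graphPred, Fin.init]
    exact (IsSigmabDef.comp₃ (P := fun a b c => c = f a b) hg (hF.comp Fin.castSucc)
      (hG.comp Fin.castSucc) (IsTermFn.proj (Fin.last m))).of_iff fun v => by
        simp [graphPred]; rfl
  · obtain ⟨B, hB, hfB⟩ := hf.bounded
    have hB' : IsTermFn fun w : Fin 2 → M => B ![w 0, w 1] :=
      hB.of_eq fun w => by
        congr 1
        ext j
        fin_cases j <;> rfl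
    exact ⟨fun xs => B ![F xs, G xs], hB'.comp₂ (f := fun a b => B ![a, b]) hF hG,
      fun xs => by simpa using hfB ![F xs, G xs]⟩

/-- Substituting term functions into a quaternary `Σᵇᵢ`-definable predicate. [folklore] -/
theorem IsSigmabDef.comp₄ {P : M → M → M → M → Prop}
    (hP : IsSigmabDef i fun w : Fin 4 → M => P (w 0) (w 1) (w 2) (w 3))
    {K : (Fin m → M) → M} (hF : IsTermFn F) (hG : IsTermFn G) (hH : IsTermFn H)
    (hK : IsTermFn K) : IsSigmabDef i fun xs => P (F xs) (G xs) (H xs) (K xs) :=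
  (closedUnderTermSubst_isSigmabDef i).comp₄ hP hF hG hH hK

/-- Substituting term functions into a quaternary `Πᵇᵢ`-definable predicate. [folklore] -/
theorem IsPibDef.comp₄ {P : M → M → M → M → Prop}
    (hP : IsPibDef i fun w : Fin 4 → M => P (w 0) (w 1) (w 2) (w 3))
    {K : (Fin m → M) → M} (hF : IsTermFn F) (hG : IsTermFn G) (hH : IsTermFn H)
    (hK : IsTermFn K) : IsPibDef i fun xs => P (F xs) (G xs) (H xs) (K xs) :=
  (closedUnderTermSubst_isPibDef i).comp₄ hP hF hG hH hK

/-- Substituting term functions into a quaternary `Δᵇᵢ`-definable predicate. [folklore] -/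
theorem IsDeltabDef.comp₄ {P : M → M → M → M → Prop}
    (hP : IsDeltabDef i fun w : Fin 4 → M => P (w 0) (w 1) (w 2) (w 3))
    {K : (Fin m → M) → M} (hF : IsTermFn F) (hG : IsTermFn G) (hH : IsTermFn H)
    (hK : IsTermFn K) : IsDeltabDef i fun xs => P (F xs) (G xs) (H xs) (K xs) :=
  (closedUnderTermSubst_isDeltabDef i).comp₄ hP hF hG hH hK

/-- Substituting term functions into a quaternary open-definable predicate. [folklore] -/
theorem IsQFDef.comp₄ {P : M → M → M → M → Prop}
    (hP : IsQFDef fun w : Fin 4 → M => P (w 0) (w 1) (w 2) (w 3))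
    {K : (Fin m → M) → M} (hF : IsTermFn F) (hG : IsTermFn G) (hH : IsTermFn H)
    (hK : IsTermFn K) : IsQFDef fun xs => P (F xs) (G xs) (H xs) (K xs) :=
  closedUnderTermSubst_isQFDef.comp₄ hP hF hG hH hK

/-- Substituting term functions into a ternary term function. [folklore] -/
theorem IsTermFn.comp₃ {f : M → M → M → M}
    (hf : IsTermFn fun w : Fin 3 → M => f (w 0) (w 1) (w 2)) (hF : IsTermFn F) (hG : IsTermFn G)
    (hH : IsTermFn H) : IsTermFn fun xs => f (F xs) (G xs) (H xs) := by
  have h1 := hf.comp ![Fin.castSucc (Fin.castSucc (Fin.last m)), Fin.castSucc (Fin.last (m + 1)),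
    Fin.last (m + 2)]
  have h2 := h1.snoc ((hH.comp Fin.castSucc).comp Fin.castSucc)
  have h3 := h2.snoc (hG.comp Fin.castSucc)
  have h4 := h3.snoc hF
  exact h4.of_eq fun xs => by simp [Function.comp_def]

/-- Substituting term functions into a ternary `Σᵇ`-definable function. [folklore] -/
theorem IsSigmabFn.comp₃ {f : M → M → M → M}
    (hf : IsSigmabFn i fun w : Fin 3 → M => f (w 0) (w 1) (w 2)) (hF : IsTermFn F)
    (hG : IsTermFn G) (hH : IsTermFn H) : IsSigmabFn i fun xs => f (F xs) (G xs) (H xs) := by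
  refine ⟨?_, ?_⟩
  · have hg : IsSigmabDef i fun w : Fin 4 → M => w 3 = f (w 0) (w 1) (w 2) :=
      hf.graph.of_iff fun w => by simp [graphPred, Fin.init]
    exact (IsSigmabDef.comp₄ (P := fun a b c d => d = f a b c) hg (hF.comp Fin.castSucc)
      (hG.comp Fin.castSucc) (hH.comp Fin.castSucc) (IsTermFn.proj (Fin.last m))).of_iff
      fun v => by simp [graphPred]; rfl
  · obtain ⟨B, hB, hfB⟩ := hf.bounded
    have hB' : IsTermFn fun w : Fin 3 → M => B ![w 0, w 1, w 2] :=
      hB.of_eq fun w => by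
        congr 1
        ext j
        fin_cases j <;> rfl
    exact ⟨fun xs => B ![F xs, G xs, H xs], hB'.comp₃ (f := fun a b c => B ![a, b, c]) hF hG hH,
      fun xs => by simpa using hfB ![F xs, G xs, H xs]⟩

/-- Substituting a `Σᵇᵢ₊₁`-definable function into a unary `Σᵇᵢ₊₁`-definable predicate.
[folklore] -/
theorem IsSigmabDef.comp₁Fn {P : M → Prop} (hP : IsSigmabDef (i + 1) fun v : Fin 1 → M => P (v 0))
    (hF : IsSigmabFn (i + 1) F) : IsSigmabDef (i + 1) fun xs => P (F xs) :=
  ((hP.comp fun _ : Fin 1 => Fin.last m).snocFn hF).of_iff fun xs => by simp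

/-- Substituting a `Σᵇᵢ₊₁`-definable function into a unary `Πᵇᵢ₊₁`-definable predicate.
[folklore] -/
theorem IsPibDef.comp₁Fn {P : M → Prop} (hP : IsPibDef (i + 1) fun v : Fin 1 → M => P (v 0))
    (hF : IsSigmabFn (i + 1) F) : IsPibDef (i + 1) fun xs => P (F xs) :=
  ((hP.comp fun _ : Fin 1 => Fin.last m).snocFn hF).of_iff fun xs => by simp

/-- Substituting a `Σᵇᵢ₊₁`-definable function into a unary `Δᵇᵢ₊₁`-definable predicate.
[folklore] -/
theorem IsDeltabDef.comp₁Fn {P : M → Prop} (hP : IsDeltabDef (i + 1) fun v : Fin 1 → M => P (v 0))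
    (hF : IsSigmabFn (i + 1) F) : IsDeltabDef (i + 1) fun xs => P (F xs) :=
  ⟨hP.1.comp₁Fn hF, hP.2.comp₁Fn hF⟩

/-- Substituting a `Σᵇᵢ₊₁`-definable function (second argument) and a term function (first
argument) into a binary `Σᵇᵢ₊₁`-definable predicate. [folklore] -/
theorem IsSigmabDef.comp₂Fn {P : M → M → Prop}
    (hP : IsSigmabDef (i + 1) fun w : Fin 2 → M => P (w 0) (w 1)) (hF : IsTermFn F)
    (hG : IsSigmabFn (i + 1) G) : IsSigmabDef (i + 1) fun xs => P (F xs) (G xs) := by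
  have h1 : IsSigmabDef (i + 1) fun u : Fin (m + 1) → M => P (F (Fin.init u)) (u (Fin.last m)) :=
    hP.comp₂ (hF.comp Fin.castSucc) (IsTermFn.proj (Fin.last m))
  exact (h1.snocFn hG).of_iff fun xs => by simp

/-- Substituting a `Σᵇᵢ₊₁`-definable function (second argument) and a term function (first
argument) into a binary `Πᵇᵢ₊₁`-definable predicate. [folklore] -/
theorem IsPibDef.comp₂Fn {P : M → M → Prop}
    (hP : IsPibDef (i + 1) fun w : Fin 2 → M => P (w 0) (w 1)) (hF : IsTermFn F)
    (hG : IsSigmabFn (i + 1) G) : IsPibDef (i + 1) fun xs => P (F xs) (G xs) := by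
  have h1 : IsPibDef (i + 1) fun u : Fin (m + 1) → M => P (F (Fin.init u)) (u (Fin.last m)) :=
    hP.comp₂ (hF.comp Fin.castSucc) (IsTermFn.proj (Fin.last m))
  exact (h1.snocFn hG).of_iff fun xs => by simp

/-- Substituting a `Σᵇᵢ₊₁`-definable function and a term function into a binary
`Δᵇᵢ₊₁`-definable predicate. [folklore] -/
theorem IsDeltabDef.comp₂Fn {P : M → M → Prop}
    (hP : IsDeltabDef (i + 1) fun w : Fin 2 → M => P (w 0) (w 1)) (hF : IsTermFn F)
    (hG : IsSigmabFn (i + 1) G) : IsDeltabDef (i + 1) fun xs => P (F xs) (G xs) :=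
  ⟨hP.1.comp₂Fn hF hG, hP.2.comp₂Fn hF hG⟩

/-- An equation between `Σᵇᵢ₊₁`-definable functions is a `Δᵇᵢ₊₁`-definable predicate.
[folklore] -/
theorem IsSigmabFn.isDeltabDef_eq (hF : IsSigmabFn (i + 1) F) (hG : IsSigmabFn (i + 1) G) :
    IsDeltabDef (i + 1) fun xs => F xs = G xs :=
  ⟨(hG.graph.snocFn hF).of_iff fun xs => by simp,
    (hG.isPibDef_graph.snocFn hF).of_iff fun xs => by simp⟩

/-- An inequality `F ≤ G` between `Σᵇᵢ₊₁`-definable functions is `Δᵇᵢ₊₁`-definable.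
[folklore] -/
theorem IsSigmabFn.isDeltabDef_le (hF : IsSigmabFn (i + 1) F) (hG : IsSigmabFn (i + 1) G) :
    IsDeltabDef (i + 1) fun xs => MLe (F xs) (G xs) := by
  -- `(xs, u) ↦ u ≤ G xs`, then substitute `u := F xs`
  have h1 : IsDeltabDef (i + 1) fun u : Fin (m + 1) → M => MLe (u (Fin.last m)) (G (Fin.init u)) :=
    ((IsQFDef.le (IsTermFn.proj 0) (IsTermFn.proj 1)).isDeltabDef (i + 1)).comp₂Fn
      (IsTermFn.proj (Fin.last m)) (hG.comp Fin.castSucc)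
  exact (h1.snocFn hF).of_iff fun xs => by simp

/-- Composition of `Σᵇᵢ₊₁`-definable functions, given a bounding term for the composite:
`y = f(G(x̄)) ↔ ∃ z ≤ t(x̄) (z = G(x̄) ∧ y = f(z))` (Buss 1986, §2.2). [cite: Buss1986, §2.2] -/
theorem IsSigmabFn.comp₁Fn {f : M → M} (hf : IsSigmabFn (i + 1) fun v : Fin 1 → M => f (v 0))
    (hG : IsSigmabFn (i + 1) G) (hbd : IsBoundedFn fun xs => f (G xs)) :
    IsSigmabFn (i + 1) fun xs => f (G xs) := by
  refine ⟨?_, hbd⟩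
  have hg : IsSigmabDef (i + 1) fun w : Fin 2 → M => w 0 = f (w 1) :=
    (hf.graph.comp ![(1 : Fin 2), 0]).of_iff fun w => by simp [graphPred, Fin.init]
  -- `v ↦ v_last = f (G (init v))`
  exact (hg.comp₂Fn (P := fun a b => a = f b) (IsTermFn.proj (Fin.last m))
    (hG.comp Fin.castSucc)).of_iff fun v => by simp [graphPred]; rfl

/-- Composition `f(F(x̄), G(x̄))` of a binary `Σᵇᵢ₊₁`-definable function `f` with a term
function `F` and a `Σᵇᵢ₊₁`-definable function `G`, given a bounding term for the composite:
`y = f(F x̄, G x̄) ↔ ∃ z ≤ t_G(x̄) (z = G x̄ ∧ y = f(F x̄, z))` (Buss 1986, §2.2).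
[cite: Buss1986, §2.2] -/
theorem IsSigmabFn.comp₂Fn {f : M → M → M}
    (hf : IsSigmabFn (i + 1) fun w : Fin 2 → M => f (w 0) (w 1)) (hF : IsTermFn F)
    (hG : IsSigmabFn (i + 1) G) (hbd : IsBoundedFn fun xs => f (F xs) (G xs)) :
    IsSigmabFn (i + 1) fun xs => f (F xs) (G xs) := by
  refine ⟨?_, hbd⟩
  obtain ⟨B, hB, hGB⟩ := hG.bounded
  have hg : IsSigmabDef (i + 1) fun u : Fin 3 → M => u 2 = f (u 0) (u 1) :=
    hf.graph.of_iff fun u => by simp [graphPred, Fin.init]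
  -- on `Fin (m + 2)` = `x̄, y, z`:  `z = G x̄ ∧ y = f (F x̄) z`
  let g : Fin (m + 1) → Fin (m + 2) :=
    Fin.snoc (α := fun _ => Fin (m + 2)) (fun k => k.castSucc.castSucc) (Fin.last (m + 1))
  have h1 : IsSigmabDef (i + 1) fun u : Fin (m + 2) → M =>
      u (Fin.last (m + 1)) = G (Fin.init (Fin.init u)) := by
    refine (hG.graph.comp g).of_iff fun u => ?_
    have e1 : (u ∘ g) (Fin.last m) = u (Fin.last (m + 1)) := by simp [g]
    have e2 : Fin.init (u ∘ g) = Fin.init (Fin.init u) := by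
      funext k
      simp [g, Fin.init]
    simp only [graphPred, e1, e2]
  have h2 : IsSigmabDef (i + 1) fun u : Fin (m + 2) → M =>
      u (Fin.castSucc (Fin.last m)) = f (F (Fin.init (Fin.init u))) (u (Fin.last (m + 1))) :=
    (hg.comp₃ (P := fun a b c => c = f a b) ((hF.comp Fin.castSucc).comp Fin.castSucc)
      (IsTermFn.proj (Fin.last (m + 1))) (IsTermFn.proj (Fin.castSucc (Fin.last m)))).of_iff
      fun u => by rfl
  refine ((h1.and h2).bexLE (hB.comp Fin.castSucc)).of_iff fun v => ?_
  simp only [Fin.snoc_last, Fin.init_snoc, Fin.snoc_castSucc, graphPred]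
  constructor
  · rintro ⟨z, -, rfl, h⟩
    exact h
  · intro h
    exact ⟨G (Fin.init v), hGB _, rfl, h⟩

/-- Composition `f(G(x̄), F(x̄))` (definable function in the first argument, term in the
second) of a binary `Σᵇᵢ₊₁`-definable function `f`, given a bounding term. [folklore] -/
theorem IsSigmabFn.comp₂Fn' {f : M → M → M}
    (hf : IsSigmabFn (i + 1) fun w : Fin 2 → M => f (w 0) (w 1)) (hG : IsSigmabFn (i + 1) G)
    (hF : IsTermFn F) (hbd : IsBoundedFn fun xs => f (G xs) (F xs)) :
    IsSigmabFn (i + 1) fun xs => f (G xs) (F xs) := by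
  have hf' : IsSigmabFn (i + 1) fun w : Fin 2 → M => f (w 1) (w 0) := by
    refine ⟨(hf.graph.comp ![(1 : Fin 3), 0, 2]).of_iff fun u => ?_, ?_⟩
    · simp [graphPred, Fin.init]
    · obtain ⟨B, hB, hfB⟩ := hf.bounded
      exact ⟨fun w => B (w ∘ ![(1 : Fin 2), 0]), hB.comp _, fun w => by
        simpa using hfB (w ∘ ![(1 : Fin 2), 0])⟩
  exact hf'.comp₂Fn (f := fun a b => f b a) hF hG hbd

end SmallArity

/-! ### The induction schemes for definable predicates -/

section Induction

variable {i : ℕ}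

/-- A `Σᵇᵢ`-definable (with parameters) unary predicate is an instance, at finitely many
parameters `p̄ ∈ Mᵏ`, of a `Σᵇᵢ` formula with variables `Fin (k + 1)` — the shape to which
the induction axioms of `BoundedArithTheories` apply: enumerate the finitely many parameters
that occur. [folklore] -/
theorem exists_formula_fin_of_isSigmabDef {P : (Fin 1 → M) → Prop} (hP : IsSigmabDef i P) :
    ∃ (k : ℕ) (ψ : Language.boundedArith.Formula (Fin (k + 1))) (p : Fin k → M),
      IsSigmab i ψ ∧ ∀ a, P ![a] ↔ ψ.Realize (Fin.snoc p a) := by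
  classical
  obtain ⟨φ, hφ, h⟩ := hP
  let S : Finset (M ⊕ Fin 1) := φ.freeVarFinset
  let k : ℕ := S.card
  let e : ↥S ≃ Fin k := S.equivFin
  let g : M ⊕ Fin 1 → Fin (k + 1) := fun x =>
    Sum.elim (fun a => if hx : (Sum.inl a : M ⊕ Fin 1) ∈ S then Fin.castSucc (e ⟨Sum.inl a, hx⟩)
      else Fin.last k) (fun _ => Fin.last k) x
  let p : Fin k → M := fun j => Sum.elim id (fun _ => mZero M) (e.symm j).1
  refine ⟨k, φ.relabel g, p, hφ.formulaRelabel g, fun a => ?_⟩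
  rw [h, Formula.realize_relabel]
  refine realize_congr_freeVarFinset φ default fun x hx => ?_
  rcases x with b | j
  · have hb : (Sum.inl b : M ⊕ Fin 1) ∈ S := hx
    simp only [Function.comp_apply, g, Sum.elim_inl, dif_pos hb, Fin.snoc_castSucc, p,
      Equiv.symm_apply_apply]
  · have hj : j = 0 := Subsingleton.elim _ _
    subst hj
    simp [g]

/-- The `IND` axiom of a `Σᵇᵢ` formula belongs to the scheme `Σᵇᵢ-IND` (Buss 1986, §2.4).
[cite: Buss1986, §2.4] -/
theorem indAxiom_mem_INDScheme {k : ℕ} {φ : Language.boundedArith.Formula (Fin (k + 1))}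
    (hφ : IsSigmab i φ) : indAxiom φ ∈ INDScheme (sigmabFormulas i) :=
  Set.mem_iUnion.2 ⟨k, Set.mem_image_of_mem _ hφ⟩

/-- The `PIND` axiom of a `Σᵇᵢ` formula belongs to the scheme `Σᵇᵢ-PIND` (Buss 1986, §2.4).
[cite: Buss1986, §2.4] -/
theorem pindAxiom_mem_PINDScheme {k : ℕ} {φ : Language.boundedArith.Formula (Fin (k + 1))}
    (hφ : IsSigmab i φ) : pindAxiom φ ∈ PINDScheme (sigmabFormulas i) :=
  Set.mem_iUnion.2 ⟨k, Set.mem_image_of_mem _ hφ⟩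

/-- The `LIND` axiom of a `Σᵇᵢ` formula belongs to the scheme `Σᵇᵢ-LIND` (Buss 1986, §2.4).
[cite: Buss1986, §2.4] -/
theorem lindAxiom_mem_LINDScheme {k : ℕ} {φ : Language.boundedArith.Formula (Fin (k + 1))}
    (hφ : IsSigmab i φ) : lindAxiom φ ∈ LINDScheme (sigmabFormulas i) :=
  Set.mem_iUnion.2 ⟨k, Set.mem_image_of_mem _ hφ⟩

/-- **`Σᵇᵢ-IND`** for definable predicates, in a structure satisfying the scheme `Σᵇᵢ-IND`: if
`P ⊆ M` is `Σᵇᵢ`-definable with parameters, `P(0)` and `∀a (P(a) → P(Sa))`, then `P = M`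
(Buss 1986, §2.4). [cite: Buss1986, §2.4] -/
theorem IsSigmabDef.induction' (hM : M ⊨ INDScheme (sigmabFormulas i)) {P : M → Prop}
    (hP : IsSigmabDef i fun v : Fin 1 → M => P (v 0)) (h0 : P (mZero M))
    (hs : ∀ a, P a → P (mSucc a)) (a : M) : P a := by
  obtain ⟨k, ψ, p, hψ, h⟩ := exists_formula_fin_of_isSigmabDef hP
  have hax := (realize_indAxiom_iff ψ).1 (hM.realize_of_mem _ (indAxiom_mem_INDScheme hψ)) p
  simp only [← h] at hax
  exact hax h0 hs a

/-- **`Σᵇᵢ-PIND`** for definable predicates, in a structure satisfying the scheme `Σᵇᵢ-PIND`: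
if `P ⊆ M` is `Σᵇᵢ`-definable with parameters, `P(0)` and `∀a (P(⌊a/2⌋) → P(a))`, then `P = M`
(Buss 1986, §2.4). [cite: Buss1986, §2.4] -/
theorem IsSigmabDef.pinduction' (hM : M ⊨ PINDScheme (sigmabFormulas i)) {P : M → Prop}
    (hP : IsSigmabDef i fun v : Fin 1 → M => P (v 0)) (h0 : P (mZero M))
    (hs : ∀ a, P (mHalf a) → P a) (a : M) : P a := by
  obtain ⟨k, ψ, p, hψ, h⟩ := exists_formula_fin_of_isSigmabDef hP
  have hax := (realize_pindAxiom_iff ψ).1 (hM.realize_of_mem _ (pindAxiom_mem_PINDScheme hψ)) p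
  simp only [← h] at hax
  exact hax h0 hs a

/-- **`Σᵇᵢ-LIND`** for definable predicates, in a structure satisfying the scheme `Σᵇᵢ-LIND`:
if `P ⊆ M` is `Σᵇᵢ`-definable with parameters, `P(0)` and `∀a (P(a) → P(Sa))`, then `P(|a|)`
for all `a` (Buss 1986, §2.4). [cite: Buss1986, §2.4] -/
theorem IsSigmabDef.linduction' (hM : M ⊨ LINDScheme (sigmabFormulas i)) {P : M → Prop}
    (hP : IsSigmabDef i fun v : Fin 1 → M => P (v 0)) (h0 : P (mZero M))
    (hs : ∀ a, P a → P (mSucc a)) (a : M) : P (mLen a) := by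
  obtain ⟨k, ψ, p, hψ, h⟩ := exists_formula_fin_of_isSigmabDef hP
  have hax := (realize_lindAxiom_iff ψ).1 (hM.realize_of_mem _ (lindAxiom_mem_LINDScheme hψ)) p
  simp only [← h] at hax
  exact hax h0 hs a

/-- **`Σᵇᵢ-IND` in models of `T₂ⁱ`** for definable predicates: if `P ⊆ M` is `Σᵇᵢ`-definable
with parameters, `P(0)` and `∀a (P(a) → P(Sa))`, then `P = M` (Buss 1986, §2.4, Definition of
`T₂ⁱ`). [cite: Buss1986, §2.4] -/
theorem IsSigmabDef.induction (hM : M ⊨ T2 i) {P : M → Prop}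
    (hP : IsSigmabDef i fun v : Fin 1 → M => P (v 0)) (h0 : P (mZero M))
    (hs : ∀ a, P a → P (mSucc a)) (a : M) : P a :=
  hP.induction' (hM.mono Set.subset_union_right) h0 hs a

/-- **`Σᵇᵢ-PIND` in models of `S₂ⁱ`** for definable predicates: if `P ⊆ M` is `Σᵇᵢ`-definable
with parameters, `P(0)` and `∀a (P(⌊a/2⌋) → P(a))`, then `P = M` (Buss 1986, §2.4, Definition
of `S₂ⁱ`). [cite: Buss1986, §2.4] -/
theorem IsSigmabDef.pinduction (hM : M ⊨ S2 i) {P : M → Prop}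
    (hP : IsSigmabDef i fun v : Fin 1 → M => P (v 0)) (h0 : P (mZero M))
    (hs : ∀ a, P (mHalf a) → P a) (a : M) : P a :=
  hP.pinduction' (hM.mono Set.subset_union_right) h0 hs a

end Induction
end Definability

end Literature.Computability.MetaComplexity
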